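import Summits.ResolutionOfSingularities.ResolutionOfSingularities.Theorems.DifferentialShade
import Summits.ResolutionOfSingularities.ResolutionOfSingularities.Theorems.CoefficientCutClasses
import HarnessLib

/-!
# StallVertexForms — decomp-res node «StallVertex» (lens-5 g20), tree file 1/5 of the node

Content VERBATIM from the decomp-res lens-5 g20 file
`HOME/decomp-res-lens-5/g20/parts/StallVertex-g20-0349e14d.lean` (sha256 0349e14dd83eb816, 869 l;
the CLEARED pin — the lens's later rev 1 d60a69dd «stall rigidity» is a superset awaiting its own critic row;
HOME = run/shared/lean/pub/decomp-res).
Critic: CRITIC-LEDGER row 142 (CLEARED 2026-08-30T20:41:19Z, DECIDED +1: the STALL VERTEX LAW `stall_vertex` in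
kernel, hypothesis-free).  Split per the
critic's order (§1–§2 halved for the 400-line limit; the three BY-NAME theorems on
`MaxContactCut.DefectWalksDeep` moved to the wiring file).  Landed by
decomp-res writer g7 in the lens's namespace `…Theorems.StallVertex`; every file of the node is in the Theses cone
(the lens imports the in-cone
`DifferentialShade` for `ifp` / `muTilde`), so the located residual `NoVertexBoundSkewStalledTailsDeep` cannot be
imported by the route file: it is
booked by RE-LOCATING the existing aside 28122 `CFNoSkewJointTailsDeep` (EXACTLY ⟺ it, hypothesis-free:
`skew_iff_vertexBound`) — one aside, not two.

§1 `Algebra` (l. 81–260): directional forms `dirForm` and their calculus (pure algebra over `MvPolynomial σ K`).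
 PROVED, 0 sorry.

[WRITER NOTE (decomp-res writer g7): file split only; namespace, opens, section variables and every declaration
exactly as in the lens (global `set_option` dropped).]

## The lens's node description (VERBATIM)

# StallVertex — decomp-res lens-5, generation 20: THE TANGENT-CONE VERTEX LAW OF A `μ̃`-STALL

Host: route `MaxContactCut`, aside `MaxContactCut.DefectWalksDeep` (stmt-…-31770); tree chain
`ExitLaw.defectWalksDeep_iff_joint'` (free-point half ∧ joint residual), `DifferentialShade.joint_iff_stalled`
(g18/g19, tree: the joint residual IS its `μ̃`-stalled part — Kawanoue–Matsuki's «Case: μ̃ stays the same»),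
`CoefficientCut.NoPlanarJointTailsDeep` / `NoSkewJointTailsDeep` (g19, tree: planar PORT window ∧ SKEW located residual).

THE CRITIC'S WINDOW (row 135/135a, item (a)/(b)): a LAW on skew tails, usable under the `μ̃`-stall, that DECIDES a typed
sub-class, with the located residual re-located EXACTLY.  THIS FILE PROVES SUCH A LAW, hypothesis-free, for every
`q = p^e`, every field of characteristic `p`, in the kernel:

* §1 `ordZero_move_le_layer` (LEMMA A, the sharp layer bound): one move of the unit acts on a generator `g` of order
  `d` carried at level `a` by `ord₀ g' ≤ (d − a) + ord₀ (dirForm d j b g)`, where `dirForm` = the initial form `in_d(g)`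
  read in the chart and translated to the new point = the tangent cone of `g` AT THE BLOWN-UP DIRECTION; the Moh
  monomial bound of `PointBlowupIFPUnitProp4` is its coarse shadow.
* §2 `stall_vertex` (THE LAW): if `μ̃` does not drop at the move `(j, b)`, then for every minimiser `g₀` of `μ_P`
  (`μ_P = d₀/a₀`):  `d₀ − a₀ · lostMass ≤ mult_{direction} {in(g₀) = 0}`,  `lostMass = Σ_{i young,
i = j ∨ b_i ≠ 0} μ_{P,D_i}`
  — after stripping the young monomial, THE INITIAL FORM OF THE MINIMISER IS A CONE WITH VERTEX THE BLOWN-UP DIRECTION.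
  `stall_vertex_origin` (untranslated moves): every monomial of `in(g₀)` has the same `u_j`-exponent
  `a₀·[j young]·μ_{P,D_j}`.  `ordZero_dirForm_ne_zero_of_stall_pos` (THE OFF-CONE KILL): at a stall with `μ̃ > 0`
  the new point lies ON the projectivised tangent cone of every minimiser — `ordZero_dirForm_eq_zero_iff`: off-cone
  `⟺ in(g₀)(b[j ↦ 1]) ≠ 0`, so the weak form of the law reads THE WALK DIRECTION IS A ZERO OF THE INITIAL FORM OF
  EVERY MINIMISER (`eval_direction_initialForm_eq_zero`, §3).
  This is the kernel shadow of K–M's mechanism (arXiv:1205.4556 pp. 16, 23–24, valid in ARBITRARY dimension): when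
  `μ̃` stays, the companion `Comp(ℛ)` (= `ℛ` with the young monomial stripped) has `μ = 1`, a new element enters the
  leading generator system and `σ` drops — here: the stripped initial form is a cone through the direction, i.e. it
  has a linear-space factor / a vertex there (the `τ`/`σ` jump), stated and proved on polynomials.
* §3 along forced walks from a root the law holds AT EVERY STALLED MOVE (`vertexLawAt_of_stall`,
  `originLawAt_of_stall`, `not_offConeAt_of_stall_pos`; the `Sing` invariant `sing_ifp` is Giraud's lemma in the chart).
* §4 THE NODE.  Target `MaxContactCut.DefectWalksDeep` ⟸ `NoFreePointTailsDeep` [tree, ProximityCut] ∧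
  `CoefficientCut.NoPlanarJointTailsDeep` [PORT, g19/tree: COSTUME(cite BenitoVillamayor2012 Thm 2.11/3.3/§4,
  KawanoueMatsuki2016 §4–5) modulo the monomial planar case] ∧ `NoVertexBoundSkewStalledTailsDeep` [THE located
  residual: skew stalled tails WITH THE VERTEX LAW AND THE ORIGIN LAW IN FORCE AT EVERY LATE MOVE; UNDECIDED;
  WEAKER by letter] — `closes` BY NAME, `defectWalksDeep_iff` EXACT; the g19 residual is re-located EXACTLY:
  `CoefficientCut.NoSkewJointTailsDeep ↔ NoVertexBoundSkewStalledTailsDeep` (`skew_iff_vertexBound`, hypothesis-free).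
  DECIDED by the law (PROVED EMPTY): `NoPositiveOffConeStalledTailsDeep` — stalled tails of positive differential shade
  with infinitely many OFF-CONE moves (direction off the tangent cone of some minimiser) do not exist; and, typed
  INSIDE THE SKEW CLASS BY LETTER and WITHOUT the stall binder (μ̃ settles — tree), `NoPositiveOffConeSkewTailsDeep`
  (`noPositiveOffConeSkewTailsDeep_holds`, `offConeSkew_of_skew`).
  Split beneath the residual (EXACT, `vertexBound_iff_monomial_onCone`): the MONOMIAL regime `μ̃ ≡ 0`
  (`NoMonomialSkewStalledTailsDeep`, K–M's monomial case) ∧ the POSITIVE ON-CONE regime `μ̃ ≡ c > 0`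
  (`NoPositiveOnConeSkewStalledTailsDeep`, every late move on-cone for every minimiser).

CENSUS (g18 walk trees, 191 roots, `g20/replay/offcone_law.py`): the law holds in 1167/1167 stalled
(edge, minimiser) pairs — WITH EQUALITY in 1167/1167 (stall rigidity, INSTRUMENTABLE sharpening); the origin law in
1099/1099 untranslated stalled pairs; off-cone stalled moves: 0 (of 1163 with `μ̃ > 0`, of 4 with `μ̃ = 0`); chart
changes under a stall occur only at PURE-POWER cones (34/34, `transport_law.py`).

WHY NOVEL: the first DIRECTION-LEVEL law of the forced-walk calculus — every earlier lens-5/lens-3 law constrains the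
letters `(j, b ≠ 0?, r, shade, o)` or a numeric ledger (`μ̃`, boundary ledger, wall potentials), all of which the census
showed self-consistent on skew stalled tails; this one constrains WHERE the walk may go (the next centre lies on the
stripped tangent cone of the minimiser, with prescribed multiplicity), the exact point at which Kawanoue–Matsuki's
weaving leaves the unit and passes to the companion/`σ`.  WHY EACH PIECE IS STRICTLY WEAKER: each class is the
target's joint residual with binders ADDED (by letter, `vertexBound_of_skew`; probes P1–P8 in `bc/Probe.lean` must-fail,
8/8), and the decided class is a theorem.

(Sources: KawanoueMatsuki2016 §4.1; Hauser2010; HauserPerlega2024; Moh1987; CossartPiltant2008; Giraud1975; Hironaka1964.)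
-/

noncomputable section

open MvPolynomial Finset
open Literature.AlgebraicGeometry.Resolution
open Literature.AlgebraicGeometry.Resolution.Hauser2010
open Literature.AlgebraicGeometry.Resolution.HauserPerlega2024
open Literature.Barriers.ResolutionOfSingularities
open Literature.AlgebraicGeometry.Resolution.PointBlowup
open Summit.ResolutionOfSingularities.ResolutionOfSingularities.Theses
open Summit.ResolutionOfSingularities.ResolutionOfSingularities.Theorems.TightDefectClasses
open Summit.ResolutionOfSingularities.ResolutionOfSingularities.Theorems.ProximityCut
open Summit.ResolutionOfSingularities.ResolutionOfSingularities.Theorems.ExitLaw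
open Summit.ResolutionOfSingularities.ResolutionOfSingularities.Theorems.DifferentialShade

namespace Summit.ResolutionOfSingularities.ResolutionOfSingularities.Theorems.StallVertex

/-! ## §1 One move acting on the initial form of a generator -/

section Algebra

variable {σ : Type*} {K : Type*} [Field K] [Fintype σ] [DecidableEq σ]

/-- **The direction form.** The initial form `in_d(G) = homogeneousComponent d G` of `G` read in the chart `u_j` of the
point blow-up and translated to the point `b` of the new exceptional divisor: a polynomial in the variables `u_i`,
`i ≠ j` (it is `u_j`-free, `dirForm_free`), namely the dehomogenisation of the form `in_d(G)` at the point
`[b ; b_j ↦ 1] ∈ ℙ(tangent space)`, re-centred there.  Its order `ord₀ (dirForm d j b G)` is the MULTIPLICITY OF THE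
PROJECTIVE TANGENT CONE `{in_d(G) = 0} ⊂ ℙ^{n-1}` AT THE DIRECTION that is blown up to the point `b` of the chart `u_j`.
[folklore: Zariski–Samuel Vol. II Ch. VIII §2 (tangent cone, initial forms); Hauser2010 §F (chart expressions)] -/
noncomputable def dirForm (d : ℕ) (j : σ) (b : σ → K) (G : MvPolynomial σ K) : MvPolynomial σ K :=
  PointBlowup.translate b (chartTransform d j (homogeneousComponent d G))

omit [Fintype σ] [DecidableEq σ] in
/-- The monomials of a homogeneous component have its degree. [folklore] -/
theorem degree_eq_of_mem_support_homogeneousComponent {d : ℕ} {G : MvPolynomial σ K} {e : σ →₀ ℕ}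
    (he : e ∈ (homogeneousComponent d G).support) : e.degree = d := by
  by_contra hne
  exact (MvPolynomial.mem_support_iff.mp he) (by rw [coeff_homogeneousComponent, if_neg hne])

omit [Fintype σ] [DecidableEq σ] in
/-- A monomial of a homogeneous component is a monomial of the polynomial. [folklore] -/
theorem mem_support_of_mem_support_homogeneousComponent {d : ℕ} {G : MvPolynomial σ K} {e : σ →₀ ℕ}
    (he : e ∈ (homogeneousComponent d G).support) : e ∈ G.support := by
  have h := MvPolynomial.mem_support_iff.mp he
  rw [coeff_homogeneousComponent] at h
  by_cases hdeg : e.degree = d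
  · rw [if_pos hdeg] at h; exact MvPolynomial.mem_support_iff.mpr h
  · rw [if_neg hdeg] at h; exact absurd rfl h

omit [Fintype σ] in
/-- The chart transform `u^e ↦ u^{e^}` of a FORM of degree `d`, taken with exponent `d`, is `u_j`-free:
`e^_j = |e| - d = 0`. [folklore] -/
theorem apply_eq_zero_of_mem_support_chartTransform_form {d : ℕ} {j : σ} {Φ : MvPolynomial σ K}
    (hΦ : ∀ e ∈ Φ.support, e.degree = d) {e : σ →₀ ℕ} (he : e ∈ (chartTransform d j Φ).support) : e j = 0 := by
  obtain ⟨e', he', rfl⟩ := exists_of_mem_support_chartTransform he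
  rw [chartExponent_apply, if_pos rfl, hΦ e' he', Nat.sub_self]

/-- A translation with `b_j = 0` keeps `u_j`-free polynomials `u_j`-free. [folklore] -/
theorem apply_eq_zero_of_mem_support_translate (b : σ → K) {j : σ} (hbj : b j = 0) {P : MvPolynomial σ K}
    (hP : ∀ e ∈ P.support, e j = 0) {β : σ →₀ ℕ} (hβ : β ∈ (PointBlowup.translate b P).support) : β j = 0 := by
  classical
  rw [MvPolynomial.mem_support_iff, translate_eq_sum_support, coeff_sum] at hβ
  obtain ⟨e, he, hne⟩ := Finset.exists_ne_zero_of_sum_ne_zero hβ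
  rw [apply_eq_of_coeff_translate_monomial_ne_zero b hbj hne]
  exact hP e he

/-- The direction form is `u_j`-free. [folklore] -/
theorem dirForm_free (d : ℕ) {j : σ} (b : σ → K) (hbj : b j = 0) (G : MvPolynomial σ K) :
    ∀ e ∈ (dirForm d j b G).support, e j = 0 :=
  fun _ he => apply_eq_zero_of_mem_support_translate b hbj
    (fun _ he' => apply_eq_zero_of_mem_support_chartTransform_form
      (fun _ he'' => degree_eq_of_mem_support_homogeneousComponent he'') he') he

/-- The direction form of a polynomial of order `d` is non-zero. [folklore] -/
theorem dirForm_ne_zero {d : ℕ} (j : σ) (b : σ → K) {G : MvPolynomial σ K} (hd : ordZero G = d) :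
    dirForm d j b G ≠ 0 :=
  translate_ne_zero b (chartTransform_ne_zero d j (homogeneousComponent_ne_zero_of_ordZero_eq hd)
    (fun _ he => (degree_eq_of_mem_support_homogeneousComponent he).ge))

omit [Fintype σ] in
/-- Adding a multiple of `u_j` to a `u_j`-free polynomial cannot raise the order: the minimal monomials of the
`u_j`-free part survive. [folklore] -/
theorem ordZero_add_X_mul_le {j : σ} {A : MvPolynomial σ K} (hA : ∀ e ∈ A.support, e j = 0)
    (B : MvPolynomial σ K) : ordZero (A + X j * B) ≤ ordZero A := by
  by_cases hA0 : A = 0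
  · rw [hA0, ordZero_zero]; exact le_top
  obtain ⟨n, hn⟩ := exists_ordZero_eq_natCast hA0
  obtain ⟨⟨e, he, hedeg⟩, -⟩ := (ordZero_eq_nat_iff A n).mp hn
  have hej : e j = 0 := hA e (MvPolynomial.mem_support_iff.mpr he)
  have hnot : j ∉ e.support := by rw [Finsupp.mem_support_iff, not_not]; exact hej
  have hcoeff : coeff e (A + X j * B) = coeff e A := by
    rw [coeff_add, coeff_X_mul', if_neg hnot, add_zero]
  rw [hn, ← hedeg]
  exact ordZero_le_of_coeff_ne_zero _ e (by rw [hcoeff]; exact he)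

omit [Fintype σ] [DecidableEq σ] in
/-- `PointBlowup.translate b (u_j^n · P) = u_j^n · PointBlowup.translate b P` when `b_j = 0`. [folklore] -/
theorem translate_X_pow_mul' (b : σ → K) {j : σ} (hbj : b j = 0) (n : ℕ) (P : MvPolynomial σ K) :
    PointBlowup.translate b (X j ^ n * P) = X j ^ n * PointBlowup.translate b P := by
  unfold PointBlowup.translate
  simp only [map_mul, map_pow, aeval_X, hbj, C_0, add_zero]

omit [Fintype σ] [DecidableEq σ] in
/-- The translation by `0` is the identity. [folklore] -/
theorem translate_eq_self {b : σ → K} (hb : ∀ i, b i = 0) (P : MvPolynomial σ K) : PointBlowup.translate b P = P := by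
  unfold PointBlowup.translate
  have h : (fun i => (X i : MvPolynomial σ K) + C (b i)) = X := by
    funext i; rw [hb i, C_0, add_zero]
  rw [h, MvPolynomial.aeval_X_left, AlgHom.id_apply]

/-- **LEMMA A (the layer bound).** One move `G ↦ PointBlowup.translate b (chartTransform a j G)` (chart `u_j`, point `b` with
`b_j = 0`, exponent `a ≤ d = ord₀ G`) satisfies
`ord₀ (PointBlowup.translate b (chartTransform a j G)) ≤ (d - a) + ord₀ (dirForm d j b G)`:
modulo `u_j^{d-a}`, the transform is `dirForm + u_j · (higher initial forms)`, the direction form is `u_j`-free, so its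
minimal monomials survive.  (The Moh bound `≤ 2d - a - …` of `PointBlowupIFPUnitProp4` is the case «some monomial»;
this is the sharp form «the tangent-cone multiplicity at the direction».) [folklore: Zariski–Samuel Vol. II
Ch. VIII §2; Hauser2010 §F] [folklore] -/
theorem ordZero_move_le_layer (b : σ → K) {j : σ} (hbj : b j = 0) {a d : ℕ} (had : a ≤ d)
    {G : MvPolynomial σ K} (hd : ordZero G = d) :
    ordZero (PointBlowup.translate b (chartTransform a j G)) ≤ ((d - a : ℕ) : ℕ∞) + ordZero (dirForm d j b G) := by
  set Φ := homogeneousComponent d G with hΦ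
  set R := G - Φ with hR
  have hdle : (d : ℕ∞) ≤ ordZero G := by rw [hd]
  have hRord : ((d + 1 : ℕ) : ℕ∞) ≤ ordZero R := succ_le_ordZero_sub_homogeneousComponent hdle
  have hG : G = Φ + R := by rw [hR]; ring
  have h1 : chartTransform a j G = X j ^ (d - a) * chartTransform d j G :=
    chartTransform_eq_X_pow_mul_chartTransform j had hdle
  have h2 : chartTransform d j G = chartTransform d j Φ + chartTransform d j R := by
    conv_lhs => rw [hG]
    exact chartTransform_add d j Φ R
  have h3 : chartTransform d j R = X j ^ (d + 1 - d) * chartTransform (d + 1) j R :=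
    chartTransform_eq_X_pow_mul_chartTransform j (Nat.le_succ d) hRord
  rw [Nat.add_sub_cancel_left] at h3
  have hT : PointBlowup.translate b (chartTransform a j G) =
      X j ^ (d - a) * (dirForm d j b G + X j * PointBlowup.translate b (chartTransform (d + 1) j R)) := by
    rw [h1, translate_X_pow_mul' b hbj, h2, HauserPerlega2024.translate_add, h3, translate_X_pow_mul' b hbj, pow_one]
    rfl
  rw [hT, ordZero_mul, ordZero_X_pow]
  exact add_le_add le_rfl (ordZero_add_X_mul_le (dirForm_free d b hbj G) _)

/-- For a non-zero `G` and a monomial `u^e` of its initial form, the UNTRANSLATED direction form (`b = 0`) has order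
at most `d - e_j`: the monomial `u^{e^}`, `|e^| = (|e| - d) + (|e| - e_j) = d - e_j`, survives in the chart transform.
[folklore: Hauser2010 §F] [folklore] -/
theorem ordZero_dirForm_origin_le {b : σ → K} (hb : ∀ i, b i = 0) {d : ℕ} (j : σ) {G : MvPolynomial σ K}
    {e : σ →₀ ℕ} (he : e ∈ (homogeneousComponent d G).support) :
    ordZero (dirForm d j b G) ≤ ((d - e j : ℕ) : ℕ∞) := by
  have hΦ : ∀ e' ∈ (homogeneousComponent d G).support, d ≤ e'.degree :=
    fun e' he' => (degree_eq_of_mem_support_homogeneousComponent he').ge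
  have hcoeff : coeff (chartExponent d j e) (chartTransform d j (homogeneousComponent d G)) ≠ 0 := by
    rw [coeff_chartExponent_chartTransform d j hΦ he]
    exact MvPolynomial.mem_support_iff.mp he
  have hdeg : (chartExponent d j e).degree = d - e j := by
    rw [degree_chartExponent, degree_eq_of_mem_support_homogeneousComponent he, Nat.sub_self, zero_add]
  unfold dirForm
  rw [translate_eq_self hb, ← hdeg]
  exact ordZero_le_of_coeff_ne_zero _ _ hcoeff

omit [Fintype σ] [DecidableEq σ] in
/-- The constant term of a translate is the value at the point. [folklore: Hauser2010 §C] [folklore] -/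
theorem constantCoeff_translate (b : σ → K) (P : MvPolynomial σ K) :
    constantCoeff (PointBlowup.translate b P) = eval b P := by
  unfold PointBlowup.translate
  induction P using MvPolynomial.induction_on with
  | C a => rw [aeval_C, MvPolynomial.algebraMap_eq, constantCoeff_C, eval_C]
  | add p q hp hq => rw [map_add, map_add, hp, hq, map_add]
  | mul_X p i hp =>
    rw [map_mul, map_mul, hp, aeval_X, map_add, constantCoeff_X, constantCoeff_C, zero_add, map_mul, eval_X]

/-- Evaluating the chart transform of a degree-`d` form at `b` = evaluating the form at the DIRECTION POINT
`b[j ↦ 1]` (the chart exponent kills `u_j`). [folklore: Hauser2010 §F] [folklore] -/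
theorem eval_chartTransform_form {d : ℕ} (j : σ) (b : σ → K) {Φ : MvPolynomial σ K}
    (hΦ : ∀ e ∈ Φ.support, e.degree = d) :
    eval b (chartTransform d j Φ) = eval (Function.update b j 1) Φ := by
  classical
  conv_rhs => rw [Φ.as_sum]
  unfold chartTransform
  rw [map_sum, map_sum]
  refine Finset.sum_congr rfl fun e he => ?_
  rw [eval_monomial, eval_monomial]
  congr 1
  rw [Finsupp.prod_fintype _ _ (fun i => pow_zero _), Finsupp.prod_fintype _ _ (fun i => pow_zero _)]
  refine Finset.prod_congr rfl fun i _ => ?_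
  rw [chartExponent_apply]
  by_cases hij : i = j
  · subst hij
    rw [if_pos rfl, hΦ e he, Nat.sub_self, pow_zero, Function.update_self, one_pow]
  · rw [if_neg hij, Function.update_of_ne hij]

/-- **OFF-CONE ⟺ THE INITIAL FORM DOES NOT VANISH AT THE DIRECTION.**  `ord₀ (dirForm d j b G) = 0` iff
`in_d(G)(b[j ↦ 1]) ≠ 0`: the move `(j, b)` is off the tangent cone of `G` exactly when the blown-up direction
`[b ; 1_j] ∈ ℙ(σ)` is not a zero of the initial form.  (So the law `ord₀ dirForm ≥ 1` says: THE WALK DIRECTION IS A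
ZERO OF THE TANGENT CONE OF EVERY MINIMISER.) [folklore + new reading] [folklore] -/
theorem ordZero_dirForm_eq_zero_iff (d : ℕ) (j : σ) (b : σ → K) (G : MvPolynomial σ K) :
    ordZero (dirForm d j b G) = 0 ↔ eval (Function.update b j 1) (homogeneousComponent d G) ≠ 0 := by
  unfold dirForm
  rw [ordZero_eq_zero_iff, constantCoeff_translate,
    eval_chartTransform_form j b (fun e he => degree_eq_of_mem_support_homogeneousComponent he)]

end Algebra

end Summit.ResolutionOfSingularities.ResolutionOfSingularities.Theorems.StallVertex
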